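import Summits.ResolutionOfSingularities.ResolutionOfSingularities.Theorems.FrobeniusLadderFInjectiveMacaulayficationRelClosedSubsetFixFinite
import Literature.AlgebraicGeometry.Resolution.CanonicalResolutionSmoothCentre
import HarnessLib

/-!
# FC″ in dimension ≥ 4 at a non-closed bad point WHOSE SPREAD RESIDUAL IS FINITE — from the finite relative fix (T3-fin) alone
# (crux `FInjectiveMacaulayfication` stmt-ResolutionOfSingularities-15315, chain w45a; res-L1-w45a-plan-1 R16.29 (3) «stub-1 NEW OBJECT
# `FCUnguardedLocDimLe3OfFiniteResidual` … AUDIT FIRST whether `RelClosedFix` at a closed ζ survives COR W′»; audit = stub-1 21:3xZ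
# «SURVIVES» (`L/res-L1-w45a-stub-1/g6-AUDIT-RelClosedFix-vs-CORW.md`); seat res-L1-w45a-stub-1 g6)

[OURS · L1 W4.5a] Support file (`--supports stmt-ResolutionOfSingularities-15315 --as helper`); NOT a statement of any manuscript;
AI-written (AI review is weaker than expert review). One `@[conjecture] def` (a CANDIDATE statement of OURS, consumed as a target) and its
proofs from the tree's (T3-fin)/(T3) candidates; no named facts.

THE POINT (after the paper kill of (T3′-pow), res-L1-w45a-tri-2 KILL-T3POW.md / plan-1 R16.29). The (A′) programme PROVED: at every non-closed
bad `η` of local dimension ≤ 3 there is an (A′) LocFix datum `c′` ((T1′) p564701, (T1‴) p569811) and it spreads to an ideal sheaf `J₀` good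
over `supp J₀ ∩ U` for an open `U ∋ η` ((T2′) p567448/p568381). What died is the GLOBAL step over the residual closed set `Z := supp J₀ ∖ U`
when `Z` meets wild strata. This file books the surviving positive statement: **if the residual `Z` is FINITE, FC″ holds at `η`** — from the
finite relative fix `RelClosedSubsetFixFinite.RelClosedSubsetFixFinite` (T3-fin, p569490; itself ⟸ the closed-point candidate
`RelClosedFix` (T3), which the audit above finds NOT refuted by COR W′: the (cl)-clause of FC″ is CM-only, and a (T3)-cure need not
dominate `Bl_{J₀}`). So the only obstruction to FC″ in local dimension ≤ 3 is a POSITIVE-dimensional spread residual.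

* `FCUnguardedOfFiniteResidual` — `FCUnguardedRungs.FCUnguardedDimGe4` VERBATIM with ONE extra hypothesis at `η` (no dimension guard):
  «some (A′) datum `c′` spreads to `J₀`, `U` with `GoodOver p X₁ J₀ (supp J₀ ∩ U)`, `η ∈ U`, and `supp J₀ ∖ U` FINITE»;
* `fcUnguardedOfFiniteResidual_of_finite : RelClosedSubsetFixFinite → FCUnguardedOfFiniteResidual` — the assembly of
  `FCUnguardedAprime.fcUnguardedLowDim_of_aprime` (v0.7) run with the finite `Z = supp J₀ ∖ U`;
* `fcUnguardedOfFiniteResidual_of_relClosedFix : RelClosedSubsetFixFinite.RelClosedFix → FCUnguardedOfFiniteResidual`.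
[folklore assembly]
-/

-- single-problem summit: the doubled namespace component is forced
set_option linter.dupNamespace false

noncomputable section

open AlgebraicGeometry CategoryTheory Literature.AlgebraicGeometry.Resolution TopologicalSpace IsLocalRing

namespace Summit.ResolutionOfSingularities.ResolutionOfSingularities.Theorems.FInjectiveMacaulayfication.FCUnguardedFiniteResidual

open Summit.ResolutionOfSingularities.ResolutionOfSingularities.Theorems.FInjectiveMacaulayfication
open Summit.ResolutionOfSingularities.ResolutionOfSingularities.Theorems.FInjectiveMacaulayfication.SliceableCentre (CMCl FCl FullCl)

/-- [OURS · CANDIDATE statement, not a fact] **FC″(dim ≥ 4) at a non-closed bad point whose (A′) datum spreads with a FINITE residual**: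
`FCUnguardedRungs.FCUnguardedDimGe4` VERBATIM with the finite-residual hypothesis inserted before the conclusion. PROVED below from (T3-fin).
[candidate statement, OURS] -/
@[conjecture] def FCUnguardedOfFiniteResidual : Prop :=
  ∀ (p : ℕ), p.Prime → ∀ (k : Type) [Field k] [CharP k p]
    (X₁ : Scheme.{0}) (f₁ : X₁ ⟶ Spec (.of k)),
      IsSeparated f₁ → LocallyOfFiniteType f₁ → QuasiCompact f₁ → IsIntegral X₁ → 4 ≤ topologicalKrullDim X₁ →
      (∀ x : X₁, (∀ d : ℕ, ringKrullDim (X₁.presheaf.stalk x) = d → ∀ s : Fin d → X₁.presheaf.stalk x,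
        (Ideal.span (Set.range s)).radical.IsMaximal → RingTheory.Sequence.IsWeaklyRegular (X₁.presheaf.stalk x) (List.ofFn s))) →
      ∀ η : X₁, (¬ IsClosed ({η} : Set X₁) ∧ ¬ (∀ d : ℕ, ringKrullDim (X₁.presheaf.stalk η) = d → ∀ s : Fin d → X₁.presheaf.stalk η,
          (Ideal.span (Set.range s)).radical.IsMaximal → ∀ t : X₁.presheaf.stalk η, (∃ e : ℕ, t ^ p ^ e ∈
            Ideal.span ((fun z : X₁.presheaf.stalk η => z ^ p ^ e) '' (Ideal.span (Set.range s) : Set (X₁.presheaf.stalk η)))) →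
              t ∈ Ideal.span (Set.range s)) ∧
        ∀ y : X₁, y ⤳ η → y ≠ η → (∀ d : ℕ, ringKrullDim (X₁.presheaf.stalk y) = d → ∀ s : Fin d → X₁.presheaf.stalk y,
          (Ideal.span (Set.range s)).radical.IsMaximal → ∀ t : X₁.presheaf.stalk y, (∃ e : ℕ, t ^ p ^ e ∈
            Ideal.span ((fun z : X₁.presheaf.stalk y => z ^ p ^ e) '' (Ideal.span (Set.range s) : Set (X₁.presheaf.stalk y)))) →
              t ∈ Ideal.span (Set.range s))) →
      -- FINITE-RESIDUAL HYPOTHESIS at η: some (A′) datum `c′` spreads to `J₀`, good over `supp J₀ ∩ U`, `η ∈ U`, with `supp J₀ ∖ U` FINITE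
      (∃ (n' : ℕ) (c' : Fin n' → X₁.presheaf.stalk η) (J₀ : X₁.IdealSheafData) (U : X₁.Opens),
        FCUnguardedAprime.LocFixData p X₁ η n' c' ∧ stalkIdeal J₀ η = Ideal.span (Set.range c') ∧ η ∈ (U : Set X₁) ∧
          FCUnguardedAprime.GoodOver p X₁ J₀ ((J₀.support : Set X₁) ∩ (U : Set X₁)) ∧ ((J₀.support : Set X₁) \ (U : Set X₁)).Finite) →
      ∃ (J : X₁.IdealSheafData) (n' : ℕ) (c' : Fin n' → X₁.presheaf.stalk η), J ≠ ⊥ ∧ η ∈ (J.support : Set X₁) ∧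
      -- the RE-CHOSEN LocFix datum c' at η (currency (A′)): nonzero, inside 𝔪_η, charts FULL over 𝔪_η
      Ideal.span (Set.range c') ≠ ⊥ ∧ Ideal.span (Set.range c') ≤ maximalIdeal (X₁.presheaf.stalk η) ∧
        (∀ (j : Fin n') (𝔔 : PrimeSpectrum (blowupAlgebra (Ideal.span (Set.range c')) (c' j))),
          𝔔.asIdeal.comap (algebraMap (X₁.presheaf.stalk η) (blowupAlgebra (Ideal.span (Set.range c')) (c' j))) =
            maximalIdeal (X₁.presheaf.stalk η) →
          IsDomain (Localization.AtPrime 𝔔.asIdeal) ∧ ∀ d : ℕ, ringKrullDim (Localization.AtPrime 𝔔.asIdeal) = d →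
            ∀ s : Fin d → Localization.AtPrime 𝔔.asIdeal, (Ideal.span (Set.range s)).radical.IsMaximal →
              RingTheory.Sequence.IsWeaklyRegular (Localization.AtPrime 𝔔.asIdeal) (List.ofFn s) ∧
              ∀ y : Localization.AtPrime 𝔔.asIdeal, (∃ e : ℕ, y ^ p ^ e ∈ Ideal.span ((fun z : Localization.AtPrime 𝔔.asIdeal => z ^ p ^ e) ''
                (Ideal.span (Set.range s) : Set (Localization.AtPrime 𝔔.asIdeal)))) → y ∈ Ideal.span (Set.range s)) ∧
      stalkIdeal J η = Ideal.span (Set.range c') ∧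
      (∀ (X₂ : Scheme.{0}) (π : X₂ ⟶ X₁), IsBlowup π J →
        (∀ x : X₂, π.base x ∈ (J.support : Set X₁) → π.base x ≠ η → ¬ IsClosed ({x} : Set X₂) →
          IsDomain (X₂.presheaf.stalk x) ∧ ∀ d : ℕ, ringKrullDim (X₂.presheaf.stalk x) = d → ∀ s : Fin d → X₂.presheaf.stalk x,
            (Ideal.span (Set.range s)).radical.IsMaximal → RingTheory.Sequence.IsWeaklyRegular (X₂.presheaf.stalk x) (List.ofFn s) ∧
            ∀ t : X₂.presheaf.stalk x, (∃ e : ℕ, t ^ p ^ e ∈ Ideal.span ((fun z : X₂.presheaf.stalk x => z ^ p ^ e) ''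
              (Ideal.span (Set.range s) : Set (X₂.presheaf.stalk x)))) → t ∈ Ideal.span (Set.range s)) ∧
        (∀ x : X₂, π.base x ∈ (J.support : Set X₁) → IsClosed ({x} : Set X₂) →
          ∀ d : ℕ, ringKrullDim (X₂.presheaf.stalk x) = d → ∀ s : Fin d → X₂.presheaf.stalk x,
            (Ideal.span (Set.range s)).radical.IsMaximal → RingTheory.Sequence.IsWeaklyRegular (X₂.presheaf.stalk x) (List.ofFn s)))

/-- **FC″ AT A FINITE-RESIDUAL POINT ⟸ (T3-fin)**: `Z := supp J₀ ∖ U` is closed, FINITE, `⊆ supp J₀`, `∌ η`, and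
`supp J₀ ∖ Z = supp J₀ ∩ U`; the finite relative fix gives `J` with the same stalks off `Z`, good over all of `supp J` — so `J_η = (c′)`,
`J ≠ ⊥`, `η ∈ supp J`, and FC″'s (A′) conjunct is the datum. (= `FCUnguardedAprime.fcUnguardedLowDim_of_aprime` with a finite `Z`.)
[folklore assembly, OURS] -/
theorem fcUnguardedOfFiniteResidual_of_finite (h₃ : RelClosedSubsetFixFinite.RelClosedSubsetFixFinite) :
    FCUnguardedOfFiniteResidual := by
  intro p hp k _ _ X₁ f₁ hs hft hqc hi h4 hCM η _ hres
  obtain ⟨n', c', J₀, U, hdat, hstalk, hηU, hgood, hfin⟩ := hres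
  -- `Z := supp J₀ ∖ U`
  have hZcl : IsClosed ((J₀.support : Set X₁) \ (U : Set X₁)) := J₀.support.isClosed.sdiff U.isOpen
  have hZsub : (J₀.support : Set X₁) \ (U : Set X₁) ⊆ (J₀.support : Set X₁) := fun x hx => hx.1
  have hZeq : (J₀.support : Set X₁) \ ((J₀.support : Set X₁) \ (U : Set X₁)) = (J₀.support : Set X₁) ∩ (U : Set X₁) := by
    ext x
    constructor
    · rintro ⟨hx, hx'⟩
      exact ⟨hx, by_contra fun hxU => hx' ⟨hx, hxU⟩⟩
    · rintro ⟨hx, hxU⟩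
      exact ⟨hx, fun h => h.2 hxU⟩
  have hgoodZ : FCUnguardedAprime.GoodOver p X₁ J₀ ((J₀.support : Set X₁) \ ((J₀.support : Set X₁) \ (U : Set X₁))) := by
    rw [hZeq]
    exact hgood
  obtain ⟨J, hJeq, hJgood⟩ := h₃ p hp k X₁ f₁ hs hft hqc hi h4 hCM J₀ _ hZcl hfin hZsub hgoodZ
  have hηZ : η ∉ (J₀.support : Set X₁) \ (U : Set X₁) := fun h => h.2 hηU
  have hJη : stalkIdeal J η = Ideal.span (Set.range c') := by rw [hJeq η hηZ, hstalk]
  obtain ⟨hne, hle, hcharts⟩ := hdat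
  refine ⟨J, n', c', ?_, ?_, hne, hle, hcharts, hJη, fun X₂ π hπ => ?_⟩
  · -- `J ≠ ⊥` since `J_η = (c′) ≠ ⊥`
    intro hJ
    apply hne
    rw [← hJη, hJ]
    exact stalkIdeal_bot η
  · -- `η ∈ supp J` since `J_η = (c′) ≤ 𝔪_η`
    exact (mem_support_iff_stalkIdeal_le J η).mpr (by rw [hJη]; exact hle)
  · obtain ⟨hnc, hcl⟩ := hJgood X₂ π hπ
    exact ⟨fun x hx _ hxcl => hnc x hx hxcl, fun x hx hxcl => hcl x hx hxcl⟩

/-- **FC″ AT A FINITE-RESIDUAL POINT ⟸ (T3) `RelClosedFix`** (the closed-point relative fix, iterated over the finite residual by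
`RelClosedSubsetFixFinite.relClosedSubsetFixFinite_of_relClosedFix`). [folklore assembly, OURS] -/
theorem fcUnguardedOfFiniteResidual_of_relClosedFix (h₃ : RelClosedSubsetFixFinite.RelClosedFix) : FCUnguardedOfFiniteResidual :=
  fcUnguardedOfFiniteResidual_of_finite (RelClosedSubsetFixFinite.relClosedSubsetFixFinite_of_relClosedFix h₃)

/-- Sanity: the finite-residual statement is a weakening of the residual `FCUnguardedDimGe4` (an honest case of FC″). [plumbing] -/
theorem fcUnguardedOfFiniteResidual_of_fcUnguardedDimGe4 (h : FCUnguardedRungs.FCUnguardedDimGe4) : FCUnguardedOfFiniteResidual :=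
  fun p hp k _ _ X₁ f₁ hs hft hqc hi h4 hCM η hη _ => h p hp k X₁ f₁ hs hft hqc hi h4 hCM η hη

end Summit.ResolutionOfSingularities.ResolutionOfSingularities.Theorems.FInjectiveMacaulayfication.FCUnguardedFiniteResidual

end
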